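import Literature.MathematicalPhysics.QuantumFieldTheory.Balaban1983to89.B9Eq326G1SupRowOfLetters

/-!
# `Balaban1983to89.B9Eq3126H1SupRowOfLetters` — T. Bałaban, *Propagators for lattice gauge theories in a background field*, Commun. Math. Phys. **99** (1985)
# 389–434 [Balaban1985BackgroundPropagators] (3.126) p. 420 (*«HB = GQ*(QGQ*)⁻¹B»*), (3.132)–(3.133) p. 422, Thm 3.1 (3.42) p. 397, (3.49) p. 399, Thm 3.3 p. 399,
# Thm 3.11 p. 416, with [Balaban1985Variational] (45) p. 285: **THE LOCAL SUP LETTERS (L) OF `(QG₁Q†)⁻¹` AND OF `H₁ = G₁∘Q†∘(QG₁Q†)⁻¹` FROM THREE DISPLAYED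
# LETTERS — (L)(G₁) (this lineage's `B9Eq326G1SupRowOfLetters` ∕ `…Adjoint`), the range ∕ size letter of `Q†` (coarse bonds → fine bonds, range one block),
# and the coarse point-block decay of `(QG₁Q†)⁻¹` (ne9-leaf-03's (FCLK)) — abstract carriers, every price HEIGHT-FREE** (the second and third slots `hH0`,
# `hInv₀` of beta-an4's INTERFACE REQUEST D4, journal `HOME/CLAIMS.log` l.64394, in ne9-leaf-03's (L)-letter algebra)

statement-level skeleton of published theorems with citation tags; proofs where landed; nothing here is a claim about the Yang–Mills mass gap

CITATION HEADER (lean-in-tree rule).  Audit cell `pub-balaban`, sub-cell `t4`, BINDER row NE9; filed by NE9 crux-team LEAF PROVER 05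
(`b2b-balaban-t4-ne9-formalise-leaf-05`, gen 87).  Composed BY NAME, nothing restated: this lineage's `B9Eq326G1SupRowOfLetters.letter_comp` (two (L) letters
compose, `local_comp_one` through `local_transport`); ne9-leaf-03's `B9Eq347LocalLetterAlgebra.local_of_range` (a finite-range operator carries (L) at every rate)
through `B9Eq347GlobalFromLocal.local_transport`, and `B9Eq347LocalFromBlockDecay.local_of_block_decay` (block decay ⟹ (L)).  SUPPLIERS at the tower (none
asserted here): (L)(G₁,k) — `B9Eq326G1SupRowAdjoint.local_letter_G1_torus` once instantiated; the coarse point-block decay of `(Q_kG₁,kQ_k†)⁻¹` — ne9-leaf-03's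
(FCLK) `B9Eq3126QG1QInvPointDecayTowerDiagonalClosed.exists_bondPoint_decay_Kinv_diagonal_closed`; the range ∕ size letter of `Q_k†` — ne9-leaf-03's (SBLT)
`B9Eq315QkSingleBondLetter` ∕ (PSK) stencil (a coarse bond source at base point `v` ↦ fine bonds in the blocks at `d_m`-distance `≤ 1` of `v`).  Sources READ
first-hand this generation in the held text (`paper:balaban1985-cmp99-background-propagators`, journal page = PDF page + 388): p. 397 Thm 3.1 (3.42), p. 399
(3.49) + Thm 3.3, p. 420 (3.126).  NOTHING of print's proof is reproduced; no constant of print is valued.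

WHAT IS PROVED (sorry-free; proof lane — no `def`; [folklore]).  Data: fine bonds `X_B` (weights `w_B`, block map `π_B`), coarse bonds `X_F` (weights `w_F`,
block map `π_F` — a coarse bond's block is its base point), the block lattice `Y` with a pseudo-metric `δ`; coarse-bond block family `r_F` by its (K1)
letter; `G₁ : X_B → X_B`, `Q† : X_F → X_B`, `K⁻¹ = (QG₁Q†)⁻¹ : X_F → X_F` continuous linear maps between the weighted carriers; every letter read through
`WL2.equiv`.
* §1 **`letter_of_range`** — an operator with `‖(Tz)(x)‖ ≤ M·sup‖z‖` whose output on a source supported over `π⁻¹(v)` vanishes beyond `δ`-range `ρ` of `v`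
  carries (L)(T; M·e^{κρ}, κ) for every `κ ≥ 0` (`local_of_range` transported) — the letter of `Q†`, `Q`, `Q̃′†`, `D_U`, `D*_U`;
  **`letter_Kinv_of_block_decay`** — `‖r_{y₁}∘K⁻¹∘r_{y₀}‖ ≤ C_K e^{−κδ(y₀,y₁)}` ⟹ (L)(K⁻¹; C_K·√μ_F∕√ω_F, κ) (`local_of_block_decay` on the coarse bonds: price
  `√μ_F∕√ω_F` = `√d` for `d` coarse bonds per site at constant weight — HEIGHT-FREE).
* §2 **`local_letter_H1_of_letters`** — (L)(G₁; B_G, κ), (L)(Q†; B_Q, κ), (L)(K⁻¹; B_K, κ), `0 ≤ κ′ < κ`… with ONE row constant `Σ_u e^{−(κ−κ′)δ(w,u)} ≤ S` ⟹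
  **(L)(G₁∘Q†∘K⁻¹; B_K·B_Q·B_G·S², κ′)** (two `letter_comp`, the outer factor always at the primitive rate `κ`); **`local_letter_H1_of_primitive`** — the same
  with `Q†`'s letter in range ∕ size form and `K⁻¹`'s in block form: `B_H = (C_K√μ_F∕√ω_F)·(M_Qe^{κρ})·B_G·S²`.
* §3 **`local_letter_H1_torus`** — `Y = T_m`, `δ = d_m`, `S = K_d(κ−κ′)` by `torusSum_le`, VOLUME-FREE — beta-an4's `hH0` shape «`∀ v z F, (z supported over the
  coarse bonds at v, ‖z(b′)‖ ≤ F) → ‖(H₁z)(b)‖ ≤ B·e^{−κ′d_m(π_B b, v)}·F`» BEFORE the `∃`-closing; the `hInv₀` shape is §1's `letter_Kinv_of_block_decay`;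
  **`local_letter_H1_torus_const`** — constant coarse weight `w_F ≡ c₁`, block mass `≤ d_F·c₁`: the weight cancels (`√μ_F∕√ω_F = √d_F`).
HONEST SCOPE.  Algebra over DISPLAYED letters; which operators carry them at the tower is the suppliers' ((FCLK), (SBLT)∕(PSK), `B9Eq326G1SupRowAdjoint`)
and the instantiator's; constants crude; nothing of [B9] Thm 3.1 ∕ 3.3 ∕ 3.11 is asserted, valued or discharged.  NOT NE9 (cell pub-balaban: NE9 NOT PRINTED ∕
NOT PROVED; «NE9 ⇐ the named binders»; row WALLED ON A MODEL (O-NE9-1; #5 UNRULED); spine PROVED 0∕9; rung (B)+1 on a finite T⁴ — NOT infinite volume, NOT mass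
gap, NOT BetaPertH, NOT Clay; HONEST DEPENDENCY: continuum YM on T⁴ ⇐ BetaPertH ∧ nine spine estimates (0/9 proved); BetaPertH ⇐ (D1) ∧ (D4) ∧ CAP+tail;
G-an2-4 gates asym, D1 and NE2/3/4).  NEW file importing this lineage's `B9Eq326G1SupRowOfLetters` (filed this generation; lands when that module's hub olean
exists); nothing modified.  Net new unproved facts: 0.
-/

noncomputable section

set_option autoImplicit false

open scoped BigOperators InnerProductSpace

namespace Literature.MathematicalPhysics.QuantumFieldTheory.Balaban1983to89.B9Eq3126H1SupRowOfLetters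

open B9Eq311L2Pairing (WL2)
open B4Sect5Torus (TSite tdist tdist_triangle tdist_nonneg tdist_symm torusSum_le)
open B4Sect5Proof (latticeConst latticeConst_nonneg)
open B9Eq347LocalLetterAlgebra (local_of_range)
open B9Eq347GlobalFromLocal (local_transport)
open B9Eq347LocalFromBlockDecay (local_of_block_decay)
open B9Eq326G1SupRowOfLetters (letter_comp)

/-! ## §1 The two primitive letters: a finite-range operator; an operator with coarse block decay -/

section Primitive

variable {𝕜 : Type*} [RCLike 𝕜] {Y : Type*} [Fintype Y] [DecidableEq Y] (δ : Y → Y → ℝ)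
  {X₁ X₂ : Type*} [Fintype X₁] [Fintype X₂] [Nonempty X₁]
  {w₁ : X₁ → ℝ} {w₂ : X₂ → ℝ} [Fact (∀ x, 0 < w₁ x)] [Fact (∀ x, 0 < w₂ x)]
  {V₁ V₂ : Type*} [NormedAddCommGroup V₁] [InnerProductSpace 𝕜 V₁] [NormedAddCommGroup V₂] [InnerProductSpace 𝕜 V₂]
  (π₁ : X₁ → Y) (π₂ : X₂ → Y)

omit [Fintype Y] [DecidableEq Y] in
/-- **A FINITE-RANGE OPERATOR CARRIES (L) AT EVERY RATE** (`B9Eq347LocalLetterAlgebra.local_of_range` read through `WL2.equiv`): `‖(Tz)(x)‖ ≤ M·sup‖z‖` and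
`(Tz)(x) = 0` whenever `z` is supported over `π₁⁻¹(v)` with `δ(π₂x, v) > ρ` ⟹ (L)(T; M·e^{κρ}, κ) for every `κ ≥ 0` — the letter of `Q†` (coarse bonds ↦ the
fine bonds of the averaging paths, which stay within one block of the source's base point: `ρ = 1`), of `Q̃′†` (`ρ = 0`), of `D_U`, `D*_U`. [folklore]
[cite: Balaban1985BackgroundPropagators, (3.126) p.420, (3.15) p.393, Thm 3.1 (3.42) p.397] -/
theorem letter_of_range (T : WL2 𝕜 w₁ V₁ →L[𝕜] WL2 𝕜 w₂ V₂) {M ρ κ : ℝ} (hκ : 0 ≤ κ)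
    (hM : ∀ (z : WL2 𝕜 w₁ V₁) (F : ℝ), (∀ x, ‖WL2.equiv 𝕜 w₁ V₁ z x‖ ≤ F) → ∀ x, ‖WL2.equiv 𝕜 w₂ V₂ (T z) x‖ ≤ M * F)
    (hρ : ∀ (v : Y) (z : WL2 𝕜 w₁ V₁), (∀ x, π₁ x ≠ v → WL2.equiv 𝕜 w₁ V₁ z x = 0) → ∀ x, ρ < δ (π₂ x) v → WL2.equiv 𝕜 w₂ V₂ (T z) x = 0)
    (v : Y) (z : WL2 𝕜 w₁ V₁) (F : ℝ) (hzv : ∀ x, π₁ x ≠ v → WL2.equiv 𝕜 w₁ V₁ z x = 0) (hzF : ∀ x, ‖WL2.equiv 𝕜 w₁ V₁ z x‖ ≤ F) (x : X₂) :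
    ‖WL2.equiv 𝕜 w₂ V₂ (T z) x‖ ≤ M * Real.exp (κ * ρ) * Real.exp (-(κ * δ (π₂ x) v)) * F := by
  have hM' : ∀ (g : X₁ → V₁) (F : ℝ), (∀ y, ‖g y‖ ≤ F) →
      ∀ x, ‖((WL2.linearEquiv 𝕜 𝕜 w₂).toLinearMap ∘ₗ (T : WL2 𝕜 w₁ V₁ →ₗ[𝕜] WL2 𝕜 w₂ V₂) ∘ₗ (WL2.linearEquiv 𝕜 𝕜 w₁).symm.toLinearMap) g x‖ ≤ M * F :=
    fun g F hg x => by simpa using hM ((WL2.equiv 𝕜 w₁ V₁).symm g) F (fun y => by simpa using hg y) x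
  have hρ' : ∀ (v : Y) (g : X₁ → V₁), (∀ y, π₁ y ≠ v → g y = 0) → ∀ x, ρ < δ (π₂ x) v →
      ((WL2.linearEquiv 𝕜 𝕜 w₂).toLinearMap ∘ₗ (T : WL2 𝕜 w₁ V₁ →ₗ[𝕜] WL2 𝕜 w₂ V₂) ∘ₗ (WL2.linearEquiv 𝕜 𝕜 w₁).symm.toLinearMap) g x = 0 :=
    fun v g hg x hx => by simpa using hρ v ((WL2.equiv 𝕜 w₁ V₁).symm g) (fun y hy => by simpa using hg y hy) x hx
  have h := local_of_range π₁ π₂ δ _ hκ hM' hρ' v (WL2.equiv 𝕜 w₁ V₁ z) F hzv hzF x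
  simpa using h

variable {rF : Y → WL2 𝕜 w₁ V₁ →L[𝕜] WL2 𝕜 w₁ V₁}
  (hrF : ∀ (y : Y) (z : WL2 𝕜 w₁ V₁) (x : X₁), WL2.equiv 𝕜 w₁ V₁ (rF y z) x = if π₁ x = y then WL2.equiv 𝕜 w₁ V₁ z x else 0)

omit [Fintype Y] in
include hrF in
/-- **THE LETTER OF `K⁻¹ = (QG₁Q†)⁻¹` FROM ITS COARSE BLOCK DECAY** (`B9Eq347LocalFromBlockDecay.local_of_block_decay` on ONE carrier — the coarse bonds, blocks =
the bonds at one base point): `‖r_{y₁}∘K⁻¹∘r_{y₀}‖ ≤ C_K·e^{−κδ(y₀,y₁)}` (ne9-leaf-03's (FCLK) shape), weights `≥ ω_F`, block masses `≤ μ_F` ⟹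
(L)(K⁻¹; C_K·√μ_F∕√ω_F, κ) — price `√d` for `d` coarse bonds per site at a constant weight: HEIGHT-FREE (beta-an4's `hInv₀` slot). [folklore]
[cite: Balaban1985BackgroundPropagators, (3.132) p.422, Thm 3.11 p.416, (3.49) p.399; Balaban1985Variational, (45) p.285] -/
theorem letter_Kinv_of_block_decay (Kinv : WL2 𝕜 w₁ V₁ →L[𝕜] WL2 𝕜 w₁ V₁) (hδs : ∀ u v, δ u v = δ v u) {CK κ ωF μF : ℝ} (hCK : 0 ≤ CK) (hωF : 0 < ωF)
    (hwF : ∀ x, ωF ≤ w₁ x) (hμF : ∀ u, ∑ x, (if π₁ x = u then w₁ x else 0) ≤ μF)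
    (hK : ∀ y₀ y₁, ‖rF y₁ ∘L Kinv ∘L rF y₀‖ ≤ CK * Real.exp (-(κ * δ y₀ y₁)))
    (v : Y) (z : WL2 𝕜 w₁ V₁) (F : ℝ) (hzv : ∀ x, π₁ x ≠ v → WL2.equiv 𝕜 w₁ V₁ z x = 0) (hzF : ∀ x, ‖WL2.equiv 𝕜 w₁ V₁ z x‖ ≤ F) (x : X₁) :
    ‖WL2.equiv 𝕜 w₁ V₁ (Kinv z) x‖ ≤ CK * Real.sqrt μF / Real.sqrt ωF * Real.exp (-(κ * δ (π₁ x) v)) * F :=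
  local_of_block_decay hrF hrF Kinv δ hCK hωF hwF hμF (fun u v => by rw [hδs]; exact hK v u) v z F hzv hzF x

end Primitive

/-! ## §2 `H₁ = G₁∘Q†∘K⁻¹`: two compositions -/

section H1

variable {𝕜 : Type*} [RCLike 𝕜] {XB XF Y : Type*} [Fintype XB] [Fintype XF] [Fintype Y] [DecidableEq Y] [Nonempty XF]
  {wB : XB → ℝ} {wF : XF → ℝ} [Fact (∀ x, 0 < wB x)] [Fact (∀ x, 0 < wF x)]
  {V : Type*} [NormedAddCommGroup V] [InnerProductSpace 𝕜 V]
  (πB : XB → Y) (πF : XF → Y) (δ : Y → Y → ℝ) (hδ0 : ∀ u v, 0 ≤ δ u v) (hδt : ∀ u y v, δ u v ≤ δ u y + δ y v) (hδs : ∀ u v, δ u v = δ v u)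
  (G : WL2 𝕜 wB V →L[𝕜] WL2 𝕜 wB V) (Qa : WL2 𝕜 wF V →L[𝕜] WL2 𝕜 wB V) (Kinv : WL2 𝕜 wF V →L[𝕜] WL2 𝕜 wF V)

omit [DecidableEq Y] in
include hδ0 hδt in
/-- **THE LETTER (L) OF `H₁ = G₁∘Q†∘K⁻¹` FROM THREE LETTERS**: (L)(G₁; B_G, κ) (fine bonds → fine bonds), (L)(Q†; B_Q, κ) (coarse bonds → fine bonds),
(L)(K⁻¹; B_K, κ) (coarse bonds → coarse bonds), `0 ≤ κ′ < κ`… with the row constant `Σ_u e^{−(κ−κ′)δ(w,u)} ≤ S` ⟹ **(L)(H₁; B_K·B_Q·S·B_G·S, κ′)** — for every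
`v`, every coarse-bond field `z` supported over `π_F⁻¹(v)` with `‖z(b′)‖ ≤ F`, every fine bond `b`: `‖(H₁z)(b)‖ ≤ B_K·B_Q·B_G·S²·e^{−κ′δ(π_B b, v)}·F`
(`letter_comp` twice, the outer factor at the primitive rate `κ` each time). [folklore] [cite: Balaban1985BackgroundPropagators, (3.126) p.420, (3.133) p.422, Thm 3.1 (3.42) p.397] -/
theorem local_letter_H1_of_letters {BG BQ BK κ κ' S : ℝ} (hBG : 0 ≤ BG) (hBQ : 0 ≤ BQ) (hBK : 0 ≤ BK) (hκ' : 0 ≤ κ') (hκ : κ' ≤ κ)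
    (hG : ∀ (v : Y) (f : WL2 𝕜 wB V) (F : ℝ), (∀ x, πB x ≠ v → WL2.equiv 𝕜 wB V f x = 0) → (∀ x, ‖WL2.equiv 𝕜 wB V f x‖ ≤ F) →
      ∀ x, ‖WL2.equiv 𝕜 wB V (G f) x‖ ≤ BG * Real.exp (-(κ * δ (πB x) v)) * F)
    (hQ : ∀ (v : Y) (z : WL2 𝕜 wF V) (F : ℝ), (∀ x, πF x ≠ v → WL2.equiv 𝕜 wF V z x = 0) → (∀ x, ‖WL2.equiv 𝕜 wF V z x‖ ≤ F) →
      ∀ x, ‖WL2.equiv 𝕜 wB V (Qa z) x‖ ≤ BQ * Real.exp (-(κ * δ (πB x) v)) * F)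
    (hK : ∀ (v : Y) (z : WL2 𝕜 wF V) (F : ℝ), (∀ x, πF x ≠ v → WL2.equiv 𝕜 wF V z x = 0) → (∀ x, ‖WL2.equiv 𝕜 wF V z x‖ ≤ F) →
      ∀ x, ‖WL2.equiv 𝕜 wF V (Kinv z) x‖ ≤ BK * Real.exp (-(κ * δ (πF x) v)) * F)
    (hS : ∀ w, ∑ u, Real.exp (-((κ - κ') * δ w u)) ≤ S)
    (v : Y) (z : WL2 𝕜 wF V) (F : ℝ) (hzv : ∀ x, πF x ≠ v → WL2.equiv 𝕜 wF V z x = 0) (hzF : ∀ x, ‖WL2.equiv 𝕜 wF V z x‖ ≤ F) (b : XB) :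
    ‖WL2.equiv 𝕜 wB V ((G ∘L Qa ∘L Kinv) z) b‖ ≤ BK * BQ * S * BG * S * Real.exp (-(κ' * δ (πB b) v)) * F := by
  have hS0 : 0 ≤ S := (Finset.sum_nonneg fun u _ => Real.exp_nonneg _).trans (hS v)
  have h₁ := letter_comp δ πF πF πB Kinv Qa hδ0 hδt hBK hBQ hκ' hκ hK hQ hS
  have h₂ := letter_comp δ πF πB πB (Qa ∘L Kinv) G hδ0 hδt (by positivity) hBG hκ' le_rfl h₁ hG hS v z F hzv hzF b
  simpa only [ContinuousLinearMap.comp_assoc] using h₂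

variable {rF : Y → WL2 𝕜 wF V →L[𝕜] WL2 𝕜 wF V}
  (hrF : ∀ (y : Y) (z : WL2 𝕜 wF V) (x : XF), WL2.equiv 𝕜 wF V (rF y z) x = if πF x = y then WL2.equiv 𝕜 wF V z x else 0)

include hδ0 hδt hδs hrF in
/-- **THE LETTER OF `H₁` FROM THE PRIMITIVE LETTERS** (§1 feeding `local_letter_H1_of_letters`): (L)(G₁; B_G, κ); `Q†` of size `M_Q` and range `ρ`; `K⁻¹` with
coarse block decay `(C_K, κ)`, coarse weights `ω_F ≤ w_F`, block masses `≤ μ_F`; `0 ≤ κ′ < κ`…, `Σ_u e^{−(κ−κ′)δ(w,u)} ≤ S` ⟹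
(L)(H₁; (C_K√μ_F∕√ω_F)·(M_Qe^{κρ})·S·B_G·S, κ′). [folklore] [cite: Balaban1985BackgroundPropagators, (3.126) p.420, (3.132)–(3.133) p.422, Thm 3.11 p.416] -/
theorem local_letter_H1_of_primitive {BG MQ ρ CK κ κ' S ωF μF : ℝ} (hBG : 0 ≤ BG) (hMQ : 0 ≤ MQ) (hCK : 0 ≤ CK) (hκ' : 0 ≤ κ') (hκ : κ' ≤ κ)
    (hωF : 0 < ωF) (hwF : ∀ x, ωF ≤ wF x) (hμF : ∀ u, ∑ x, (if πF x = u then wF x else 0) ≤ μF)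
    (hG : ∀ (v : Y) (f : WL2 𝕜 wB V) (F : ℝ), (∀ x, πB x ≠ v → WL2.equiv 𝕜 wB V f x = 0) → (∀ x, ‖WL2.equiv 𝕜 wB V f x‖ ≤ F) →
      ∀ x, ‖WL2.equiv 𝕜 wB V (G f) x‖ ≤ BG * Real.exp (-(κ * δ (πB x) v)) * F)
    (hQM : ∀ (z : WL2 𝕜 wF V) (F : ℝ), (∀ x, ‖WL2.equiv 𝕜 wF V z x‖ ≤ F) → ∀ x, ‖WL2.equiv 𝕜 wB V (Qa z) x‖ ≤ MQ * F)
    (hQρ : ∀ (v : Y) (z : WL2 𝕜 wF V), (∀ x, πF x ≠ v → WL2.equiv 𝕜 wF V z x = 0) → ∀ x, ρ < δ (πB x) v → WL2.equiv 𝕜 wB V (Qa z) x = 0)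
    (hKblk : ∀ y₀ y₁, ‖rF y₁ ∘L Kinv ∘L rF y₀‖ ≤ CK * Real.exp (-(κ * δ y₀ y₁)))
    (hS : ∀ w, ∑ u, Real.exp (-((κ - κ') * δ w u)) ≤ S)
    (v : Y) (z : WL2 𝕜 wF V) (F : ℝ) (hzv : ∀ x, πF x ≠ v → WL2.equiv 𝕜 wF V z x = 0) (hzF : ∀ x, ‖WL2.equiv 𝕜 wF V z x‖ ≤ F) (b : XB) :
    ‖WL2.equiv 𝕜 wB V ((G ∘L Qa ∘L Kinv) z) b‖ ≤
      (CK * Real.sqrt μF / Real.sqrt ωF) * (MQ * Real.exp (κ * ρ)) * S * BG * S * Real.exp (-(κ' * δ (πB b) v)) * F := by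
  have hκ0 : 0 ≤ κ := hκ'.trans hκ
  have hQ := letter_of_range δ πF πB Qa hκ0 hQM hQρ
  have hK := letter_Kinv_of_block_decay δ πF hrF Kinv hδs hCK hωF hwF hμF hKblk
  exact local_letter_H1_of_letters πB πF δ hδ0 hδt G Qa Kinv (by positivity) (by positivity) (by positivity) hκ' hκ hG hQ hK hS v z F hzv hzF b

end H1

/-! ## §3 Over the coarse torus `T_m` -/

section Lattice

variable {𝕜 : Type*} [RCLike 𝕜] {XB XF : Type*} [Fintype XB] [Fintype XF] [Nonempty XF] {d : ℕ} {m : Fin d → ℕ}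
  {wB : XB → ℝ} {wF : XF → ℝ} [Fact (∀ x, 0 < wB x)] [Fact (∀ x, 0 < wF x)]
  {V : Type*} [NormedAddCommGroup V] [InnerProductSpace 𝕜 V]
  (πB : XB → TSite d m) (πF : XF → TSite d m)
  (G : WL2 𝕜 wB V →L[𝕜] WL2 𝕜 wB V) (Qa : WL2 𝕜 wF V →L[𝕜] WL2 𝕜 wB V) (Kinv : WL2 𝕜 wF V →L[𝕜] WL2 𝕜 wF V)
  {rF : TSite d m → WL2 𝕜 wF V →L[𝕜] WL2 𝕜 wF V}
  (hrF : ∀ (y : TSite d m) (z : WL2 𝕜 wF V) (x : XF), WL2.equiv 𝕜 wF V (rF y z) x = if πF x = y then WL2.equiv 𝕜 wF V z x else 0)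

include hrF in
/-- **THE LETTER (L) OF `H₁` OVER THE COARSE TORUS** (`δ = d_m`, `S = K_d(κ−κ′)` by `torusSum_le`, `1 ≤ m_i`, VOLUME-FREE; `0 ≤ κ′ < κ`): beta-an4's `hH0` shape
«`∀ v z F, (z supported over the coarse bonds at v, ‖z(b′)‖ ≤ F) → ‖(H₁z)(b)‖ ≤ B_H·e^{−κ′d_m(π_B b, v)}·F`», `B_H = (C_K√μ_F∕√ω_F)·(M_Qe^{κρ})·B_G·K_d(κ−κ′)²`,
BEFORE the `∃`-closing over print's window. [folklore] [cite: Balaban1985BackgroundPropagators, (3.126) p.420, (3.133) p.422, Thm 3.1 (3.42) p.397, Thm 3.11 p.416]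
[cite: Balaban1984PropagatorsII, Lemma 2.1 (2.61) p.234] -/
theorem local_letter_H1_torus (hm : ∀ i, 1 ≤ m i) {BG MQ ρ CK κ κ' ωF μF : ℝ} (hBG : 0 ≤ BG) (hMQ : 0 ≤ MQ) (hCK : 0 ≤ CK) (hκ' : 0 ≤ κ')
    (hκ : κ' < κ) (hωF : 0 < ωF) (hwF : ∀ x, ωF ≤ wF x) (hμF : ∀ u, ∑ x, (if πF x = u then wF x else 0) ≤ μF)
    (hG : ∀ (v : TSite d m) (f : WL2 𝕜 wB V) (F : ℝ), (∀ x, πB x ≠ v → WL2.equiv 𝕜 wB V f x = 0) → (∀ x, ‖WL2.equiv 𝕜 wB V f x‖ ≤ F) →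
      ∀ x, ‖WL2.equiv 𝕜 wB V (G f) x‖ ≤ BG * Real.exp (-(κ * tdist m (πB x) v)) * F)
    (hQM : ∀ (z : WL2 𝕜 wF V) (F : ℝ), (∀ x, ‖WL2.equiv 𝕜 wF V z x‖ ≤ F) → ∀ x, ‖WL2.equiv 𝕜 wB V (Qa z) x‖ ≤ MQ * F)
    (hQρ : ∀ (v : TSite d m) (z : WL2 𝕜 wF V), (∀ x, πF x ≠ v → WL2.equiv 𝕜 wF V z x = 0) →
      ∀ x, ρ < tdist m (πB x) v → WL2.equiv 𝕜 wB V (Qa z) x = 0)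
    (hKblk : ∀ y₀ y₁, ‖rF y₁ ∘L Kinv ∘L rF y₀‖ ≤ CK * Real.exp (-(κ * tdist m y₀ y₁)))
    (v : TSite d m) (z : WL2 𝕜 wF V) (F : ℝ) (hzv : ∀ x, πF x ≠ v → WL2.equiv 𝕜 wF V z x = 0) (hzF : ∀ x, ‖WL2.equiv 𝕜 wF V z x‖ ≤ F)
    (b : XB) :
    ‖WL2.equiv 𝕜 wB V ((G ∘L Qa ∘L Kinv) z) b‖ ≤
      (CK * Real.sqrt μF / Real.sqrt ωF) * (MQ * Real.exp (κ * ρ)) * latticeConst d (κ - κ') * BG * latticeConst d (κ - κ') *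
        Real.exp (-(κ' * tdist m (πB b) v)) * F :=
  local_letter_H1_of_primitive πB πF (tdist m) (tdist_nonneg m) (fun u y w => tdist_triangle hm u y w) (tdist_symm hm) G Qa Kinv hrF hBG hMQ hCK hκ'
    hκ.le hωF hwF hμF hG hQM hQρ hKblk (fun w => torusSum_le d hm (sub_pos.2 hκ) w) v z F hzv hzF b

include hrF in
/-- **THE SAME AT CONSTANT COARSE WEIGHT** (`w_F ≡ c₁`, coarse-bond block mass `≤ d_F·c₁` — `d_F = d` bonds per site): the weight CANCELS,
`B_H = (C_K·√d_F)·(M_Qe^{κρ})·K_d(κ−κ′)·B_G·K_d(κ−κ′)` — the form in which an `∃`-first END picks its constant BEFORE the height. [folklore]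
[cite: Balaban1985BackgroundPropagators, (3.126) p.420, (3.133) p.422, Thm 3.1 (3.42) p.397, Thm 3.11 p.416] -/
theorem local_letter_H1_torus_const (hm : ∀ i, 1 ≤ m i) {BG MQ ρ CK κ κ' c₁ dF : ℝ} (hBG : 0 ≤ BG) (hMQ : 0 ≤ MQ) (hCK : 0 ≤ CK) (hκ' : 0 ≤ κ')
    (hκ : κ' < κ) (hc₁ : 0 < c₁) (hwF : ∀ x, wF x = c₁) (hdF : 0 ≤ dF) (hμF : ∀ u, ∑ x, (if πF x = u then wF x else 0) ≤ dF * c₁)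
    (hG : ∀ (v : TSite d m) (f : WL2 𝕜 wB V) (F : ℝ), (∀ x, πB x ≠ v → WL2.equiv 𝕜 wB V f x = 0) → (∀ x, ‖WL2.equiv 𝕜 wB V f x‖ ≤ F) →
      ∀ x, ‖WL2.equiv 𝕜 wB V (G f) x‖ ≤ BG * Real.exp (-(κ * tdist m (πB x) v)) * F)
    (hQM : ∀ (z : WL2 𝕜 wF V) (F : ℝ), (∀ x, ‖WL2.equiv 𝕜 wF V z x‖ ≤ F) → ∀ x, ‖WL2.equiv 𝕜 wB V (Qa z) x‖ ≤ MQ * F)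
    (hQρ : ∀ (v : TSite d m) (z : WL2 𝕜 wF V), (∀ x, πF x ≠ v → WL2.equiv 𝕜 wF V z x = 0) →
      ∀ x, ρ < tdist m (πB x) v → WL2.equiv 𝕜 wB V (Qa z) x = 0)
    (hKblk : ∀ y₀ y₁, ‖rF y₁ ∘L Kinv ∘L rF y₀‖ ≤ CK * Real.exp (-(κ * tdist m y₀ y₁)))
    (v : TSite d m) (z : WL2 𝕜 wF V) (F : ℝ) (hzv : ∀ x, πF x ≠ v → WL2.equiv 𝕜 wF V z x = 0) (hzF : ∀ x, ‖WL2.equiv 𝕜 wF V z x‖ ≤ F)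
    (b : XB) :
    ‖WL2.equiv 𝕜 wB V ((G ∘L Qa ∘L Kinv) z) b‖ ≤
      (CK * Real.sqrt dF) * (MQ * Real.exp (κ * ρ)) * latticeConst d (κ - κ') * BG * latticeConst d (κ - κ') *
        Real.exp (-(κ' * tdist m (πB b) v)) * F := by
  have h := local_letter_H1_torus πB πF G Qa Kinv hrF hm (ωF := c₁) (μF := dF * c₁) hBG hMQ hCK hκ' hκ hc₁ (fun x => (hwF x).ge) hμF hG hQM hQρ
    hKblk v z F hzv hzF b
  have hs : 0 < Real.sqrt c₁ := Real.sqrt_pos.2 hc₁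
  have e2 : CK * Real.sqrt (dF * c₁) / Real.sqrt c₁ = CK * Real.sqrt dF := by
    rw [Real.sqrt_mul hdF, mul_div_assoc, mul_div_assoc, div_self hs.ne', mul_one]
  rw [e2] at h
  exact h

end Lattice

end Literature.MathematicalPhysics.QuantumFieldTheory.Balaban1983to89.B9Eq3126H1SupRowOfLetters

end
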